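import Summits.Ventures.AbcSig.Rows.XTemplateC
import Summits.Ventures.AbcSig.Levels.N450

/-!
# Venture AbcSig — ROW `XnYn15Z2EvenV2`: `xⁿ + yⁿ = 15 z²` (`xy` even) over NORM-FORM level certificates (GENERATED by p-lean g4 `gen4/cprow.py`)

HONEST FRAMING. A row of a COMPUTATION cell (`pub-abcsig`); a CONDITIONAL theorem, no claim on ABC or any summit.
Hypotheses: `BS04Package` (CITED: [BS04] Lemma 3.3 + (3.1) + Lemma 4.2); per level `DataComplete` (COMPUTED: the orbit list
of the certified engine level file is complete) and, for the norm-form level files, `RefinesCPSymAll` (COMPUTED: the listed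
characteristic polynomials annihilate `± c_ℓ` on the newforms matching each orbit datum — same engine file); and the listed
per-orbit exclusions `hX_…` (CITED: the row of record names the printed argument / cell module for each — [BS04, Prop. 4.4 /
4.6], M4 Kraus, M6c, M2·; nothing of those is checked here). Everything else is kernel-checked: the recipe templates and the
level files 450 (ordinary ℤ[θ] certificates). Exponent range: prime `n ≥ 11`, `n ∤ 15`.
v2 ROW, xy-EVEN half (level 2·15² = 450, ordinary tree certificates): CITED per the row of record: the n = 11 residues of the two orbits of level 450 with residual [7, 11] (module M4 Kraus / [BS04, Prop 4.4] per R3).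
Residues / orbits left as CITED hypotheses: N450 orbit_450_1: not sieve-eliminable → CITED hX_; N450 orbit_450_2 @ [11]: CITED hX_; N450 orbit_450_3: not sieve-eliminable → CITED hX_; N450 orbit_450_4: not sieve-eliminable → CITED hX_; N450 orbit_450_5 @ [11]: CITED hX_; N450 orbit_450_6: not sieve-eliminable → CITED hX_; N450 orbit_450_7: not sieve-eliminable → CITED hX_.
Row of record: `census/rows/C1/C1-C15-all.md` (sha16 `b2613d49164632d6`; v2 R8 SIGNED 2026-08-23T02:50:12Z by referee (ref-g23)); p1's statement of record: `Rows.C1CellEven 15 11 ∅` (`Rows/StatementsC1b.lean` / `Rows/Statements.lean`).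
-/

namespace Summit.Ventures.AbcSig

/-- Row `XnYn15Z2EvenV2`: no primitive solution of `xⁿ + yⁿ = 15 z²` (`xy` even) for prime `n ≥ 11`, `n ∤ 15`,
conditional on the named hypotheses (norm-form level certificates in the kernel). -/
theorem xrow_XnYn15Z2EvenV2 (M : NewformModel) (hP : M.BS04Package)
    (hD450 : M.DataComplete 450 level450Orbits)
    (n : ℕ) (hn : n.Prime) (hmin : 11 ≤ n) (hnC : ¬ n ∣ 15)
    (hX_orbit_450_1 : M.Excludes 450 orbit_450_1
      (fun S => S.A = 1 ∧ S.B = 1 ∧ S.C = 15 ∧ S.n = n ∧ 2 ∣ S.a * S.b))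
    (hX_orbit_450_2 : n ∈ ([11] : List ℕ) → M.Excludes 450 orbit_450_2
      (fun S => S.A = 1 ∧ S.B = 1 ∧ S.C = 15 ∧ S.n = n ∧ 2 ∣ S.a * S.b))
    (hX_orbit_450_3 : M.Excludes 450 orbit_450_3
      (fun S => S.A = 1 ∧ S.B = 1 ∧ S.C = 15 ∧ S.n = n ∧ 2 ∣ S.a * S.b))
    (hX_orbit_450_4 : M.Excludes 450 orbit_450_4
      (fun S => S.A = 1 ∧ S.B = 1 ∧ S.C = 15 ∧ S.n = n ∧ 2 ∣ S.a * S.b))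
    (hX_orbit_450_5 : n ∈ ([11] : List ℕ) → M.Excludes 450 orbit_450_5
      (fun S => S.A = 1 ∧ S.B = 1 ∧ S.C = 15 ∧ S.n = n ∧ 2 ∣ S.a * S.b))
    (hX_orbit_450_6 : M.Excludes 450 orbit_450_6
      (fun S => S.A = 1 ∧ S.B = 1 ∧ S.C = 15 ∧ S.n = n ∧ 2 ∣ S.a * S.b))
    (hX_orbit_450_7 : M.Excludes 450 orbit_450_7
      (fun S => S.A = 1 ∧ S.B = 1 ∧ S.C = 15 ∧ S.n = n ∧ 2 ∣ S.a * S.b))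
    (a b c : ℤ) (hpar : 2 ∣ a * b) : ¬ IsPrimitiveSolution 1 1 15 n a b c := by
  have h7 : 7 ≤ n := by omega
  have hsq : Squarefree (15 : ℕ) := by
    have h : (15 : ℕ) = 3 * 5 := by norm_num
    rw [h, Nat.squarefree_mul (by norm_num)]
    exact ⟨(Nat.prime_iff.mp (by norm_num)).squarefree, (Nat.prime_iff.mp (by norm_num)).squarefree⟩
  exact xrow_template_even 15 hsq (by decide) M hP hD450 n hn h7 hnC
    (level450_sieve n hn h7 (fun o => M.Excludes 450 o
      (fun S => S.A = 1 ∧ S.B = 1 ∧ S.C = 15 ∧ S.n = n ∧ 2 ∣ S.a * S.b) ∨ M.ExcludesStd 450 o n) (Or.inl hX_orbit_450_1) (fun hmem => by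
      rcases (by simpa using hmem : n = 7 ∨ n = 11) with rfl | rfl
      · omega
      · exact Or.inl (hX_orbit_450_2 (by simp))) (Or.inl hX_orbit_450_3) (Or.inl hX_orbit_450_4) (fun hmem => by
      rcases (by simpa using hmem : n = 7 ∨ n = 11) with rfl | rfl
      · omega
      · exact Or.inl (hX_orbit_450_5 (by simp))) (Or.inl hX_orbit_450_6) (Or.inl hX_orbit_450_7))
    a b c hpar

end Summit.Ventures.AbcSig
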